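import Mathlib

/-!
# T4RadialProjectionAC — radial projection of a translated sphere is absolutely continuous (pub-balaban, row T4-D.G-AC1)

Pure measure theory over Mathlib (no Bałaban content; every declaration is [folklore]).  This is module M1 of the
cell memo `HOME/t4/T4-EST-HaarAC.md`: the one-variable analytic input of the proof that Bałaban's block averaging
`U ↦ Ū` (B12 = [Balaban1987RG1] (0.3)–(0.4) p. 253, typed as `BlockAveraging.avgFun su2Mean`) maps the product Haar
measure `dU` to an ABSOLUTELY CONTINUOUS measure (`T4FiniteEpsInhabited.HaarAC`), which is what makes the
renormalization transform `Tρ` of B7 (10) p. 19 / B12 (0.13) p. 254 exist as a function (cell GAPS G-pv26g2-1).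

Contents (E a finite-dimensional real normed / inner product space, `μ` an additive Haar measure):
* §1 `measure_inter_preimage_null_of_injOn`, `measure_inter_preimage_null_of_hasStrictFDerivAt`,
  `restrict_map_absolutelyContinuous` — LEMMA A: a measurable map which on an open set `O` has an invertible strict
  derivative everywhere pushes `μ|_O` to a measure `≪ μ` (inverse function theorem for local injectivity, a countable
  subcover, and Mathlib's change-of-variables identity `lintegral_abs_det_fderiv_eq_addHaar_image`).
* §2 `rankOneEquiv` — the Sherman–Morrison inverse of `id + φ(·) a` when `1 + φ a ≠ 0`.
* §3 `degenerateCone a = {v | ⟪a, v⟫ = -‖v‖}` is `μ`-null when `2 ≤ dim E` (it is `{0}`, a ray, or the image of the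
  hyperplane `aᗮ` under a map differentiable off `0`; `Measure.addHaar_submodule`,
  `addHaar_image_eq_zero_of_differentiableOn_of_addHaar_eq_zero`).
* §4 `radialTranslate a : sphere 0 1 → sphere 0 1`, `u ↦ (a + u)/‖a + u‖`, and the theorem
  `toSphere_map_radialTranslate_absolutelyContinuous : μ.toSphere.map (radialTranslate a) ≪ μ.toSphere` for EVERY
  `a : E` (via the 1-homogeneous extension `homExt a : v ↦ v + ‖v‖ • a`, whose derivative `id + ⟪v/‖v‖, ·⟫ a` is
  invertible off the degenerate cone, and the cone description `toSphere_apply'` of the sphere measure).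
-/

namespace Literature.MathematicalPhysics.QuantumFieldTheory.Balaban1983to89.T4RadialProjectionAC

open MeasureTheory Set Metric Function
open scoped Pointwise ENNReal RealInnerProductSpace Topology

noncomputable section

/-! ## 1. Lemma A: maps with invertible derivative preserve null sets backwards -/

section LemmaA

variable {E : Type*} [NormedAddCommGroup E] [NormedSpace ℝ E] [FiniteDimensional ℝ E] [MeasurableSpace E]
  [BorelSpace E] (μ : Measure E) [μ.IsAddHaarMeasure]

/-- Local form: if `f` is injective on a measurable set `s` and differentiable there with `det f′ ≠ 0`, then
`s ∩ f⁻¹(N)` is null for every null `N` (from `∫⁻_{s ∩ f⁻¹N} |det f′| dμ = μ (f '' (s ∩ f⁻¹ N)) ≤ μ N = 0`). [folklore] -/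
theorem measure_inter_preimage_null_of_injOn {f : E → E} {f' : E → E →L[ℝ] E} {s N : Set E}
    (hs : MeasurableSet s) (hN : MeasurableSet N) (hfm : Measurable f)
    (hf' : ∀ x ∈ s, HasFDerivWithinAt f (f' x) s x) (hf : InjOn f s) (hdet : ∀ x ∈ s, (f' x).det ≠ 0)
    (hμN : μ N = 0) : μ (s ∩ f ⁻¹' N) = 0 := by
  set t := s ∩ f ⁻¹' N with ht_def
  have ht : MeasurableSet t := hs.inter (hfm hN)
  have hts : t ⊆ s := inter_subset_left
  have hf't : ∀ x ∈ t, HasFDerivWithinAt f (f' x) t x := fun x hx => (hf' x (hts hx)).mono hts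
  have hinj : InjOn f t := hf.mono hts
  have himg : f '' t ⊆ N := by
    rintro _ ⟨x, hx, rfl⟩
    exact hx.2
  have h1 : (∫⁻ x in t, ENNReal.ofReal |(f' x).det| ∂μ) = 0 := by
    rw [lintegral_abs_det_fderiv_eq_addHaar_image μ ht hf't hinj]
    exact measure_mono_null himg hμN
  have hae : (fun x => ENNReal.ofReal |(f' x).det|) =ᵐ[μ.restrict t] 0 :=
    (lintegral_eq_zero_iff' (aemeasurable_ofReal_abs_det_fderivWithin μ ht hf't)).1 h1
  have hsub : t ⊆ {x | ENNReal.ofReal |(f' x).det| ≠ 0} := fun x hx => by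
    simp only [mem_setOf_eq, ne_eq, ENNReal.ofReal_eq_zero, not_le, abs_pos]
    exact hdet x (hts hx)
  have h2 : (μ.restrict t) {x | ENNReal.ofReal |(f' x).det| ≠ 0} = 0 := by
    rw [Filter.EventuallyEq, ae_iff] at hae
    simpa using hae
  have h3 : (μ.restrict t) t = 0 := measure_mono_null hsub h2
  rwa [Measure.restrict_apply_self] at h3

/-- LEMMA A (null-set form): if `f` is measurable and has an INVERTIBLE strict derivative at every point of an open set
`O`, then `O ∩ f⁻¹(N)` is null for every null `N` (local injectivity by the inverse function theorem, a countable
subcover, and the local form). [folklore] -/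
theorem measure_inter_preimage_null_of_hasStrictFDerivAt {f : E → E} {f' : E → E ≃L[ℝ] E} {O N : Set E}
    (hO : IsOpen O) (hN : MeasurableSet N) (hfm : Measurable f)
    (hf' : ∀ x ∈ O, HasStrictFDerivAt f (f' x : E →L[ℝ] E) x) (hμN : μ N = 0) : μ (O ∩ f ⁻¹' N) = 0 := by
  classical
  have key : ∀ x ∈ O, ∃ V : Set E, IsOpen V ∧ x ∈ V ∧ InjOn f V := fun x hx =>
    ⟨((hf' x hx).toOpenPartialHomeomorph f).source, ((hf' x hx).toOpenPartialHomeomorph f).open_source,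
      (hf' x hx).mem_toOpenPartialHomeomorph_source, ((hf' x hx).toOpenPartialHomeomorph f).injOn⟩
  choose! V hVo hxV hinjV using key
  obtain ⟨T, hTO, hTc, hcov⟩ : ∃ T ⊆ O, T.Countable ∧ O ⊆ ⋃ x ∈ T, V x :=
    TopologicalSpace.countable_cover_nhdsWithin fun x hx =>
      mem_nhdsWithin_of_mem_nhds ((hVo x hx).mem_nhds (hxV x hx))
  have hsub : O ∩ f ⁻¹' N ⊆ ⋃ x ∈ T, (V x ∩ O) ∩ f ⁻¹' N := by
    intro y hy
    obtain ⟨x, hxT, hyV⟩ : ∃ x ∈ T, y ∈ V x := by simpa only [mem_iUnion, exists_prop] using hcov hy.1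
    exact mem_biUnion hxT ⟨⟨hyV, hy.1⟩, hy.2⟩
  refine measure_mono_null hsub ((measure_biUnion_null_iff hTc).2 fun x hxT => ?_)
  have hxO := hTO hxT
  refine measure_inter_preimage_null_of_injOn μ ((hVo x hxO).inter hO).measurableSet hN hfm
    (f' := fun y => (f' y : E →L[ℝ] E)) (fun y hy => ((hf' y hy.2).hasFDerivAt).hasFDerivWithinAt)
    ((hinjV x hxO).mono inter_subset_left) (fun y _ => ?_) hμN
  exact (LinearEquiv.isUnit_det' (f' y).toLinearEquiv).ne_zero

/-- LEMMA A (measure form): under the same hypotheses `(μ|_O) ∘ f⁻¹ ≪ μ`. [folklore] -/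
theorem restrict_map_absolutelyContinuous {f : E → E} {f' : E → E ≃L[ℝ] E} {O : Set E} (hO : IsOpen O)
    (hfm : Measurable f) (hf' : ∀ x ∈ O, HasStrictFDerivAt f (f' x : E →L[ℝ] E) x) :
    (μ.restrict O).map f ≪ μ := by
  refine Measure.AbsolutelyContinuous.mk fun N hN hμN => ?_
  rw [Measure.map_apply hfm hN, Measure.restrict_apply (hfm hN), inter_comm]
  exact measure_inter_preimage_null_of_hasStrictFDerivAt μ hO hN hfm hf' hμN

end LemmaA

/-! ## 2. The Sherman–Morrison equivalence `id + φ(·) a` -/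

section RankOne

variable {E : Type*} [NormedAddCommGroup E] [NormedSpace ℝ E]

/-- `h ↦ h + φ(h) • a` is a continuous linear automorphism when `1 + φ(a) ≠ 0`, with inverse
`k ↦ k - (1 + φ a)⁻¹ φ(k) • a` (Sherman–Morrison). [folklore] -/
def rankOneEquiv (φ : E →L[ℝ] ℝ) (a : E) (h : 1 + φ a ≠ 0) : E ≃L[ℝ] E :=
  ContinuousLinearEquiv.equivOfInverse (ContinuousLinearMap.id ℝ E + φ.smulRight a)
    (ContinuousLinearMap.id ℝ E - ((1 + φ a)⁻¹ • φ).smulRight a)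
    (by
      intro x
      show x + φ x • a - ((1 + φ a)⁻¹ • φ) (x + φ x • a) • a = x
      have hc : ((1 + φ a)⁻¹ • φ) (x + φ x • a) = φ x := by
        show (1 + φ a)⁻¹ * φ (x + φ x • a) = φ x
        rw [map_add, map_smul, smul_eq_mul]
        field_simp
      rw [hc, add_sub_cancel_right])
    (by
      intro x
      show (x - (((1 + φ a)⁻¹ • φ) x) • a) + φ (x - (((1 + φ a)⁻¹ • φ) x) • a) • a = x
      have hc : φ (x - (((1 + φ a)⁻¹ • φ) x) • a) = ((1 + φ a)⁻¹ • φ) x := by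
        show φ (x - ((1 + φ a)⁻¹ * φ x) • a) = (1 + φ a)⁻¹ * φ x
        rw [map_sub, map_smul, smul_eq_mul]
        field_simp
        ring
      rw [hc, sub_add_cancel])

/-- The forward map of `rankOneEquiv`. [folklore] -/
@[simp] theorem coe_rankOneEquiv (φ : E →L[ℝ] ℝ) (a : E) (h : 1 + φ a ≠ 0) :
    (rankOneEquiv φ a h : E →L[ℝ] E) = ContinuousLinearMap.id ℝ E + φ.smulRight a := rfl

end RankOne

/-! ## 3. The degenerate cone and its nullity -/

section Cone

variable {E : Type*} [NormedAddCommGroup E] [InnerProductSpace ℝ E]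

/-- The DEGENERATE CONE of `a`: the vectors `v` with `⟪a, v⟫ = -‖v‖` — exactly the directions in which the derivative
`id + ⟪v/‖v‖, ·⟫ a` of `homExt a : v ↦ v + ‖v‖ • a` fails to be invertible, together with `0`. [folklore] -/
def degenerateCone (a : E) : Set E := {v | ⟪a, v⟫ = -‖v‖}

/-- Membership. [folklore] -/
theorem mem_degenerateCone {a v : E} : v ∈ degenerateCone a ↔ ⟪a, v⟫ = -‖v‖ := Iff.rfl

/-- `0` is degenerate. [folklore] -/
theorem zero_mem_degenerateCone (a : E) : (0 : E) ∈ degenerateCone a := by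
  simp [mem_degenerateCone]

/-- The degenerate cone is closed. [folklore] -/
theorem isClosed_degenerateCone (a : E) : IsClosed (degenerateCone a) :=
  isClosed_eq (continuous_const.inner continuous_id) continuous_norm.neg

/-- The parametrisation of the degenerate cone over the hyperplane `aᗮ` (case `1 < ‖a‖`):
`ψ_a w = w - (‖w‖ / (‖a‖ √(‖a‖² - 1))) • a`. [folklore] -/
def conePsi (a : E) (w : E) : E := w - (‖w‖ * (‖a‖ * Real.sqrt (‖a‖ ^ 2 - 1))⁻¹) • a

/-- `ψ_a` is differentiable away from `0`. [folklore] -/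
theorem differentiableAt_conePsi (a : E) {w : E} (hw : w ≠ 0) : DifferentiableAt ℝ (conePsi a) w := by
  unfold conePsi
  exact differentiableAt_id.sub (((differentiableAt_id.norm ℝ hw).mul_const _).smul_const a)

/-- STRUCTURE OF THE DEGENERATE CONE: for `a ≠ 0` it is contained in `{0} ∪ ℝa ∪ ψ_a(aᗮ ∖ {0})`
(empty-ish for `‖a‖ < 1`, the ray `-ℝ₊ a` for `‖a‖ = 1`, a cone over a sphere of `aᗮ` for `1 < ‖a‖`). [folklore] -/
theorem degenerateCone_subset {a : E} (ha : a ≠ 0) :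
    degenerateCone a ⊆ {0} ∪ ((ℝ ∙ a : Submodule ℝ E) : Set E) ∪
      conePsi a '' (((ℝ ∙ a)ᗮ : Submodule ℝ E) \ {0}) := by
  intro v hv
  rw [mem_degenerateCone] at hv
  by_cases hv0 : v = 0
  · exact Or.inl (Or.inl hv0)
  -- decomposition v = w + t • a with w ⊥ a
  set t : ℝ := ⟪a, v⟫ / ‖a‖ ^ 2 with ht_def
  set w : E := v - t • a with hw_def
  have ha2 : 0 < ‖a‖ ^ 2 := by positivity
  have haw : ⟪a, w⟫ = 0 := by
    rw [hw_def, inner_sub_right, inner_smul_right, real_inner_self_eq_norm_sq, ht_def,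
      div_mul_cancel₀ _ ha2.ne', sub_self]
  have hwK : w ∈ ((ℝ ∙ a)ᗮ : Submodule ℝ E) := by
    rw [Submodule.mem_orthogonal_singleton_iff_inner_right]
    exact haw
  have hvwt : v = w + t • a := by rw [hw_def]; abel
  -- ‖v‖² = ‖w‖² + t² ‖a‖²
  have hnorm : ‖v‖ ^ 2 = ‖w‖ ^ 2 + t ^ 2 * ‖a‖ ^ 2 := by
    have h1 : ⟪w, t • a⟫ = 0 := by rw [inner_smul_right, real_inner_comm, haw, mul_zero]
    rw [hvwt, norm_add_sq_real, h1, mul_zero, add_zero, norm_smul, mul_pow, Real.norm_eq_abs, sq_abs]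
  -- ⟪a, v⟫ = t ‖a‖²
  have hav : ⟪a, v⟫ = t * ‖a‖ ^ 2 := by rw [ht_def, div_mul_cancel₀ _ ha2.ne']
  have ht0 : t ≤ 0 := by
    have : t * ‖a‖ ^ 2 ≤ 0 := by rw [← hav, hv]; exact neg_nonpos.2 (norm_nonneg _)
    nlinarith
  -- the key relation ‖w‖² = t² ‖a‖² (‖a‖² - 1)
  have hkey : ‖w‖ ^ 2 = t ^ 2 * ‖a‖ ^ 2 * (‖a‖ ^ 2 - 1) := by
    have h1 : (t * ‖a‖ ^ 2) ^ 2 = ‖v‖ ^ 2 := by rw [← hav, hv, neg_sq]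
    nlinarith
  rcases lt_trichotomy ‖a‖ 1 with h1 | h1 | h1
  · -- ‖a‖ < 1 : forces v = 0
    exfalso
    have hw0 : ‖w‖ ^ 2 ≤ 0 := by
      rw [hkey]
      have : ‖a‖ ^ 2 - 1 < 0 := by nlinarith [norm_nonneg a]
      nlinarith [sq_nonneg t, norm_nonneg a]
    have hw0' : w = 0 := by
      have : ‖w‖ ^ 2 = 0 := le_antisymm hw0 (sq_nonneg _)
      exact norm_eq_zero.1 (pow_eq_zero_iff two_ne_zero |>.1 this)
    have htz : t = 0 := by
      have h3 : t ^ 2 * ‖a‖ ^ 2 * (‖a‖ ^ 2 - 1) = 0 := by rw [← hkey, hw0', norm_zero]; ring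
      have h4 : ‖a‖ ^ 2 - 1 ≠ 0 := by nlinarith [norm_nonneg a]
      have h5 : t ^ 2 = 0 := by
        rcases mul_eq_zero.1 h3 with h3 | h3
        · rcases mul_eq_zero.1 h3 with h3 | h3
          · exact h3
          · exact absurd h3 ha2.ne'
        · exact absurd h3 h4
      exact pow_eq_zero_iff two_ne_zero |>.1 h5
    apply hv0
    rw [hvwt, hw0', htz, zero_smul, add_zero]
  · -- ‖a‖ = 1 : v ∈ ℝ a
    refine Or.inl (Or.inr ?_)
    have hw0' : w = 0 := by
      have : ‖w‖ ^ 2 = 0 := by rw [hkey, h1]; ring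
      exact norm_eq_zero.1 (pow_eq_zero_iff two_ne_zero |>.1 this)
    rw [hvwt, hw0', zero_add]
    exact Submodule.smul_mem _ _ (Submodule.mem_span_singleton_self a)
  · -- 1 < ‖a‖ : v = ψ_a w with w ∈ aᗮ, w ≠ 0
    refine Or.inr ⟨w, ⟨hwK, ?_⟩, ?_⟩
    · intro hw0'
      rw [mem_singleton_iff] at hw0'
      have h3 : t ^ 2 * ‖a‖ ^ 2 * (‖a‖ ^ 2 - 1) = 0 := by rw [← hkey, hw0', norm_zero]; ring
      have h4 : ‖a‖ ^ 2 - 1 ≠ 0 := by nlinarith [norm_nonneg a]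
      have h5 : t ^ 2 = 0 := by
        rcases mul_eq_zero.1 h3 with h3 | h3
        · rcases mul_eq_zero.1 h3 with h3 | h3
          · exact h3
          · exact absurd h3 ha2.ne'
        · exact absurd h3 h4
      have htz : t = 0 := pow_eq_zero_iff two_ne_zero |>.1 h5
      apply hv0
      rw [hvwt, hw0', htz, zero_smul, add_zero]
    · -- conePsi a w = v
      have hs : 0 < ‖a‖ ^ 2 - 1 := by nlinarith [norm_nonneg a]
      have hsq : Real.sqrt (‖a‖ ^ 2 - 1) ^ 2 = ‖a‖ ^ 2 - 1 := Real.sq_sqrt hs.le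
      have hsq0 : 0 < Real.sqrt (‖a‖ ^ 2 - 1) := Real.sqrt_pos.2 hs
      have hapos : 0 < ‖a‖ := norm_pos_iff.2 ha
      set M : ℝ := ‖a‖ * Real.sqrt (‖a‖ ^ 2 - 1) with hM_def
      have hM : 0 < M := mul_pos hapos hsq0
      have hwM : ‖w‖ = -t * M := by
        have hnn : 0 ≤ -t * M := mul_nonneg (neg_nonneg.2 ht0) hM.le
        have hsq' : ‖w‖ ^ 2 = (-t * M) ^ 2 := by
          rw [hkey, hM_def, mul_pow, mul_pow, hsq]
          ring
        exact (pow_left_inj₀ (norm_nonneg _) hnn two_ne_zero).1 hsq'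
      have htw : t = -(‖w‖ * M⁻¹) := by
        rw [hwM]
        field_simp
      rw [hvwt, htw, conePsi, ← hM_def, neg_smul, sub_eq_add_neg]

variable [FiniteDimensional ℝ E] [MeasurableSpace E] [BorelSpace E] (μ : Measure E) [μ.IsAddHaarMeasure]

/-- THE DEGENERATE CONE IS NULL when `2 ≤ dim E`. [folklore] -/
theorem measure_degenerateCone (a : E) (h2 : 2 ≤ Module.finrank ℝ E) : μ (degenerateCone a) = 0 := by
  have : Nontrivial E := Module.nontrivial_of_finrank_pos (R := ℝ) (by omega)
  by_cases ha : a = 0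
  · have hsub : degenerateCone a ⊆ {0} := fun v hv => by
      rw [mem_degenerateCone, ha, inner_zero_left, eq_comm, neg_eq_zero, norm_eq_zero] at hv
      exact hv
    exact measure_mono_null hsub (measure_singleton _)
  · refine measure_mono_null (degenerateCone_subset ha) ?_
    refine measure_union_null (measure_union_null (measure_singleton _) ?_) ?_
    · apply Measure.addHaar_submodule
      intro htop
      have h := finrank_span_singleton (K := ℝ) ha
      rw [htop, finrank_top] at h
      omega
    · apply addHaar_image_eq_zero_of_differentiableOn_of_addHaar_eq_zero μ
      · intro w hw
        have hw0 : w ≠ 0 := by simpa using hw.2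
        exact (differentiableAt_conePsi a hw0).differentiableWithinAt
      · apply measure_mono_null sdiff_subset
        apply Measure.addHaar_submodule
        intro htop
        have hmem : a ∈ ((ℝ ∙ a)ᗮ : Submodule ℝ E) := by
          rw [htop]
          trivial
        rw [Submodule.mem_orthogonal_singleton_iff_inner_right] at hmem
        exact ha (inner_self_eq_zero.1 hmem)

end Cone

/-! ## 4. The radial projection of a translated sphere -/

section Sphere

variable {E : Type*} [NormedAddCommGroup E] [InnerProductSpace ℝ E]

open scoped Classical in
/-- The underlying function `x ↦ (a + x)/‖a + x‖` on `E` (value `x` where `a + x = 0`). [folklore] -/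
def rtFun (a x : E) : E := if a + x = 0 then x else ‖a + x‖⁻¹ • (a + x)

/-- It maps unit vectors to unit vectors. [folklore] -/
theorem norm_rtFun {a x : E} (hx : ‖x‖ = 1) : ‖rtFun a x‖ = 1 := by
  unfold rtFun
  split_ifs with h
  · exact hx
  · rw [norm_smul, norm_inv, norm_norm, inv_mul_cancel₀ (norm_ne_zero_iff.2 h)]

/-- **RADIAL PROJECTION OF THE TRANSLATE BY `a`**: the self-map `u ↦ (a + u)/‖a + u‖` of the unit sphere (value `u` at
the single point `u = -a` when `‖a‖ = 1`). [folklore] -/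
def radialTranslate (a : E) (u : sphere (0 : E) 1) : sphere (0 : E) 1 :=
  ⟨rtFun a u, by
    rw [mem_sphere_zero_iff_norm]
    exact norm_rtFun (norm_eq_of_mem_sphere u)⟩

/-- The value of `radialTranslate`. [folklore] -/
theorem coe_radialTranslate (a : E) (u : sphere (0 : E) 1) : (radialTranslate a u : E) = rtFun a u := rfl

/-- The 1-HOMOGENEOUS EXTENSION `v ↦ v + ‖v‖ • a` of the translate (it maps the ray of `u` to the ray of `a + u`). [folklore] -/
def homExt (a v : E) : E := v + ‖v‖ • a

/-- `homExt a` is continuous. [folklore] -/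
theorem continuous_homExt (a : E) : Continuous (homExt a) :=
  continuous_id.add (continuous_norm.smul continuous_const)

/-- Strict derivative of the norm away from `0`: `D‖·‖(v) = ⟪v, ·⟫/‖v‖`. [folklore] -/
theorem hasStrictFDerivAt_norm' {v : E} (hv : v ≠ 0) :
    HasStrictFDerivAt (fun x : E => ‖x‖) (‖v‖⁻¹ • innerSL ℝ v) v := by
  have h1 := hasStrictFDerivAt_norm_sq v
  have hv2 : (‖v‖ ^ 2 : ℝ) ≠ 0 := by positivity
  have h2 : HasStrictDerivAt (fun r : ℝ => Real.sqrt r) (1 / (2 * Real.sqrt (‖v‖ ^ 2))) (‖v‖ ^ 2) :=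
    Real.hasStrictDerivAt_sqrt hv2
  have h3 := h2.comp_hasStrictFDerivAt v h1
  have hfun : ((fun r : ℝ => Real.sqrt r) ∘ fun x : E => ‖x‖ ^ 2) = fun x : E => ‖x‖ := by
    funext x
    simp [Real.sqrt_sq (norm_nonneg x)]
  rw [hfun] at h3
  refine h3.congr_fderiv ?_
  ext y
  simp only [_root_.smul_apply, _root_.add_apply, two_smul, innerSL_apply_apply, smul_eq_mul,
    Real.sqrt_sq (norm_nonneg v)]
  ring

/-- Strict derivative of `homExt a` away from `0`: `id + ⟪v, ·⟫/‖v‖ ⊗ a`. [folklore] -/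
theorem hasStrictFDerivAt_homExt (a : E) {v : E} (hv : v ≠ 0) :
    HasStrictFDerivAt (homExt a) (ContinuousLinearMap.id ℝ E + (‖v‖⁻¹ • innerSL ℝ v).smulRight a) v :=
  (hasStrictFDerivAt_id v).add ((hasStrictFDerivAt_norm' hv).smul_const a)

/-- Off the degenerate cone the derivative of `homExt a` is invertible: `1 + ⟪v, a⟫/‖v‖ ≠ 0`. [folklore] -/
theorem one_add_ne_zero_of_not_mem {a v : E} (hv : v ∉ degenerateCone a) :
    1 + (‖v‖⁻¹ • innerSL ℝ v) a ≠ 0 := by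
  have hv0 : v ≠ 0 := fun h => hv (h ▸ zero_mem_degenerateCone a)
  have hn : ‖v‖ ≠ 0 := norm_ne_zero_iff.2 hv0
  simp only [_root_.smul_apply, innerSL_apply_apply, smul_eq_mul]
  intro h
  apply hv
  rw [mem_degenerateCone, real_inner_comm]
  have h' : ‖v‖ + ⟪v, a⟫ = 0 := by
    have := congrArg (fun r => ‖v‖ * r) h
    simpa [mul_add, mul_inv_cancel_left₀ hn] using this
  linarith

variable [MeasurableSpace E] [BorelSpace E] [FiniteDimensional ℝ E]

/-- It is Borel measurable. [folklore] -/
theorem measurable_rtFun (a : E) : Measurable (rtFun a) := by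
  unfold rtFun
  refine Measurable.ite ?_ measurable_id ?_
  · exact (isClosed_eq (continuous_const.add continuous_id) continuous_const).measurableSet
  · exact ((measurable_id.const_add a).norm.inv).smul (measurable_id.const_add a)

/-- `radialTranslate a` is measurable. [folklore] -/
theorem measurable_radialTranslate (a : E) : Measurable (radialTranslate a) :=
  ((measurable_rtFun a).comp measurable_subtype_coe).subtype_mk

variable (μ : Measure E) [μ.IsAddHaarMeasure]

/-- LEMMA A applied to `homExt a`: preimages of null sets are null off the degenerate cone. [folklore] -/
theorem measure_inter_preimage_homExt_null (a : E) {N : Set E} (hN : MeasurableSet N) (hμN : μ N = 0) :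
    μ ((degenerateCone a)ᶜ ∩ homExt a ⁻¹' N) = 0 := by
  classical
  refine measure_inter_preimage_null_of_hasStrictFDerivAt μ (isClosed_degenerateCone a).isOpen_compl hN
    (continuous_homExt a).measurable
    (f' := fun v => if h : 1 + (‖v‖⁻¹ • innerSL ℝ v) a ≠ 0 then rankOneEquiv _ a h
      else ContinuousLinearEquiv.refl ℝ E) (fun v hv => ?_) hμN
  have hv0 : v ≠ 0 := fun h => hv (h ▸ zero_mem_degenerateCone a)
  have h1 := one_add_ne_zero_of_not_mem hv
  simp only [dif_pos h1, coe_rankOneEquiv]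
  exact hasStrictFDerivAt_homExt a hv0

/-- Scaling: if the truncated cone `(0,1) • S` is null then the full cone `(0,∞) • S` is null. [folklore] -/
theorem measure_Ioi_smul_null {S : Set E} (h : μ (Ioo (0 : ℝ) 1 • S) = 0) : μ (Ioi (0 : ℝ) • S) = 0 := by
  have hsub : Ioi (0 : ℝ) • S ⊆ ⋃ k : ℕ, ((k : ℝ) + 1) • (Ioo (0 : ℝ) 1 • S) := by
    intro v hv
    obtain ⟨r, hr, x, hx, rfl⟩ := Set.mem_smul.1 hv
    obtain ⟨k, hk⟩ := exists_nat_gt r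
    have hk1 : (0 : ℝ) < (k : ℝ) + 1 := by positivity
    refine mem_iUnion.2 ⟨k, ?_⟩
    rw [Set.mem_smul_set]
    refine ⟨(r / ((k : ℝ) + 1)) • x, Set.smul_mem_smul ⟨div_pos hr hk1, ?_⟩ hx, ?_⟩
    · rw [div_lt_one hk1]
      linarith
    · rw [smul_smul, mul_div_cancel₀ _ hk1.ne']
  refine measure_mono_null hsub ((measure_iUnion_null_iff).2 fun k => ?_)
  rw [Measure.addHaar_smul, h, mul_zero]

/-- A `toSphere`-null set spans a `μ`-null cone. [folklore] -/
theorem measure_cone_null_of_toSphere_null {N : Set (sphere (0 : E) 1)} (hN : MeasurableSet N)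
    (h0 : 0 < Module.finrank ℝ E) (hσ : μ.toSphere N = 0) :
    μ (Ioi (0 : ℝ) • (((↑) : sphere (0 : E) 1 → E) '' N)) = 0 := by
  rw [Measure.toSphere_apply' μ hN] at hσ
  have h : μ (Ioo (0 : ℝ) 1 • (((↑) : sphere (0 : E) 1 → E) '' N)) = 0 := by
    rcases mul_eq_zero.1 hσ with h | h
    · exact absurd h (by exact_mod_cast h0.ne')
    · exact h
  exact measure_Ioi_smul_null μ h

/-- **M1: THE RADIAL PROJECTION OF A TRANSLATED SPHERE IS ABSOLUTELY CONTINUOUS.** For every `a : E` (`2 ≤ dim E`) the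
push-forward of the sphere measure `μ.toSphere` under `u ↦ (a + u)/‖a + u‖` is absolutely continuous with respect to
`μ.toSphere`. (Cone criterion `toSphere_apply'`; the cone over the preimage is carried by `homExt a` into the cone over
the null set, off the null degenerate cone where Lemma A applies.) [folklore] -/
theorem toSphere_map_radialTranslate_absolutelyContinuous (a : E) (h2 : 2 ≤ Module.finrank ℝ E) :
    (μ.toSphere).map (radialTranslate a) ≪ μ.toSphere := by
  refine Measure.AbsolutelyContinuous.mk fun N hN hσN => ?_
  rw [Measure.map_apply (measurable_radialTranslate a) hN,
    Measure.toSphere_apply' μ (measurable_radialTranslate a hN)]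
  suffices h : μ (Ioo (0 : ℝ) 1 • (((↑) : sphere (0 : E) 1 → E) '' (radialTranslate a ⁻¹' N))) = 0 by
    rw [h, mul_zero]
  set M := toMeasurable μ (Ioi (0 : ℝ) • (((↑) : sphere (0 : E) 1 → E) '' N)) with hM
  have hMnull : μ M = 0 := by
    rw [hM, measure_toMeasurable]
    exact measure_cone_null_of_toSphere_null μ hN (by omega) hσN
  have hA := measure_inter_preimage_homExt_null μ a (measurableSet_toMeasurable _ _) hMnull
  have hD := measure_degenerateCone μ a h2
  refine measure_mono_null (fun v hv => ?_) (measure_union_null hA hD)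
  by_cases hvD : v ∈ degenerateCone a
  · exact Or.inr hvD
  refine Or.inl ⟨hvD, ?_⟩
  obtain ⟨r, hr, x, hx, rfl⟩ := Set.mem_smul.1 hv
  obtain ⟨u, hu, rfl⟩ := hx
  have hu1 : ‖(u : E)‖ = 1 := norm_eq_of_mem_sphere u
  have hau : a + (u : E) ≠ 0 := by
    intro h0
    apply hvD
    rw [mem_degenerateCone, eq_neg_of_add_eq_zero_left h0, inner_neg_left, inner_smul_right,
      real_inner_self_eq_norm_sq, hu1, norm_smul, Real.norm_eq_abs, abs_of_pos hr.1, hu1]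
    ring
  show homExt a (r • (u : E)) ∈ M
  apply subset_toMeasurable
  rw [Set.mem_smul]
  refine ⟨r * ‖a + (u : E)‖, mul_pos hr.1 (norm_pos_iff.2 hau), (radialTranslate a u : E),
    mem_image_of_mem _ hu, ?_⟩
  rw [coe_radialTranslate, rtFun, if_neg hau, homExt, norm_smul, Real.norm_eq_abs, abs_of_pos hr.1, hu1, mul_one,
    smul_smul, mul_assoc, mul_inv_cancel₀ (norm_ne_zero_iff.2 hau), mul_one, smul_add, add_comm]

end Sphere

end

end Literature.MathematicalPhysics.QuantumFieldTheory.Balaban1983to89.T4RadialProjectionAC
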